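import Mathlib
import HarnessLib
import Literature.Probability.Process.PointStationaryLaw
import Literature.MathematicalPhysics.StatisticalMechanics.RootEnergy
import Literature.MathematicalPhysics.StatisticalMechanics.BarlowStacking
import Literature.Geometry.DiscreteGeometry.KissingPatterns
import Summits.AtomisticToContinuum.Crystallization.Theses.BenjaminiSchrammPeriodicSupport
import Summits.AtomisticToContinuum.Crystallization.Theorems.PalmUnimodularRigidityCruxesToPalmRigidity
import Summits.AtomisticToContinuum.Crystallization.Theorems.PalmUnimodularRigidityShellsToBarlowChart
import Summits.AtomisticToContinuum.Crystallization.Theorems.PalmUnimodularRigidityBenjaminiSchrammLimit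
import Summits.AtomisticToContinuum.Crystallization.Theorems.ExcessDecayLiouvilleCrysEnergyLimit

/-!
# Skeleton line `redirect-pieces` — crux `GroundStatesChargePeriodic` (stmt-AtomisticToContinuum-2911) BY NAME
# from the FOUR stubs of its BC2 redirect (route `BenjaminiSchrammPeriodicSupport`, sub-problem `Crystallization`)

Self-contained registration copy (the farm builds new `Cruxes/…` modules with a lag, so this file does not import
`Cruxes/GroundStatesChargePeriodic/Pieces.lean` or `Lines/periodic_window_support.lean`; it restates their content over the
ROUTE's decls and concludes `Theses.BenjaminiSchrammPeriodicSupport.GroundStatesChargePeriodic` by name).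

Redirect: `GroundStatesChargePeriodic ⇐ MinimiserShells ∧ LayeredLawsChargePeriodic (∧ 9230 ✓ ∧ 0626 ✓)`; the glue
(§ Glue: `matched_periodic_of_matched_event`, `GroundStatesChargePeriodic_of_subs`, `periodicSupport_of_pieces`) is REAL; piece 2 is
reduced by the line `periodic-window-support` (§ Symbolic coordinates: `stub_exactLayered`, `stub_periodicWindowCharged`,
`stub_windowMatching`, composition `LayeredLawsChargePeriodic_of_stubs` REAL); piece 1 is the shared crux 9225 (`stub_minimiserShells`,
verbatim; live lines under `Cruxes/MinimiserShells`).  The only `sorry`s are the four `stub_*`.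

Stubs: `stub_minimiserShells` (open-problem, = 9225) · `stub_exactLayered` (XL, rigidity) · `stub_periodicWindowCharged` (L/XL, HARDEST
new stub: selection in support, symbolic coordinates) · `stub_windowMatching` (M, deterministic geometry).  Cards: `Lines/periodic-window-support.md`,
`SPLIT.md`, `Ideas/periodic-window-support.md`.
-/

namespace Summit.AtomisticToContinuum.Crystallization.Cruxes.GroundStatesChargePeriodic.RedirectPieces

noncomputable section

open scoped Topology ENNReal
open Filter Set MeasureTheory Literature.MathematicalPhysics.StatisticalMechanics
  Literature.Probability.Process
open Summit.AtomisticToContinuum.Crystallization.Theses.BenjaminiSchrammPeriodicSupport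

/-- Local shorthand for `ℝ³`. -/
abbrev E3 : Type := EuclideanSpace ℝ (Fin 3)

/-! ## The two open pieces (verbatim; the route's children once the split is rendered) -/

/-- **Piece 1** = shared item stmt-AtomisticToContinuum-9225 `MinimiserShells`, verbatim. -/
def MinimiserShells : Prop :=
  ∀ δ : ℝ, 0 < δ → ∀ P : MeasureTheory.Measure (MeasureTheory.Measure (EuclideanSpace ℝ (Fin 3))), MeasureTheory.IsProbabilityMeasure P → (∀ᵐ μ ∂P, (∃ S : Set (EuclideanSpace ℝ (Fin 3)), (0 : EuclideanSpace ℝ (Fin 3)) ∈ S ∧ (∀ x ∈ S, ∀ y ∈ S, x ≠ y → δ ≤ dist x y) ∧ μ = (MeasureTheory.Measure.count : MeasureTheory.Measure (EuclideanSpace ℝ (Fin 3))).restrict S)) → (∀ g : MeasureTheory.Measure (EuclideanSpace ℝ (Fin 3)) → EuclideanSpace ℝ (Fin 3) → ENNReal, Measurable (Function.uncurry g) → ∫⁻ μ, ∫⁻ y, g μ y ∂μ ∂P = ∫⁻ μ, ∫⁻ y, g (MeasureTheory.Measure.map (fun z => z - y) μ) (-y) ∂μ ∂P) → (∫ μ,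 (∫ y, Literature.MathematicalPhysics.StatisticalMechanics.lennardJones ‖y‖ ∂μ) / 2 ∂P) ≤ (⨅ Q : Literature.MathematicalPhysics.StatisticalMechanics.PeriodicConfiguration 3, Q.energyPerParticle Literature.MathematicalPhysics.StatisticalMechanics.lennardJones) → ∀ᵐ μ ∂P, (∃ a : ℝ, 9 / 10 ≤ a ∧ a ≤ 1 ∧ ∃ T : Finset (EuclideanSpace ℝ (Fin 3)), (↑T : Set (EuclideanSpace ℝ (Fin 3))) = {y : EuclideanSpace ℝ (Fin 3) | μ {y} ≠ 0 ∧ y ≠ 0 ∧ ‖y‖ ≤ 5 / 4 * a} ∧ (Literature.Geometry.DiscreteGeometry.ShellCloseTo (a / 100) T (Finset.image (fun v : EuclideanSpace ℝ (Fin 3) => a • v) Literature.Geometry.DiscreteGeometry.fccKissingPattern) ∨ Literature.Geometry.DiscreteGeometry.ShellCloseTo (a / 100) T (Finset.image (fun v : EuclideanSpace ℝ (Fin 3) => a • v) Literature.Geometry.DiscreteGeometry.hcpKissingPattern)))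

/-- **Piece 2** = the new crux `LayeredLawsChargePeriodic`, verbatim. -/
def LayeredLawsChargePeriodic : Prop :=
  ∀ δ : ℝ, 0 < δ → ∀ P : MeasureTheory.Measure (MeasureTheory.Measure (EuclideanSpace ℝ (Fin 3))), MeasureTheory.IsProbabilityMeasure P → (∀ᵐ μ ∂P, Literature.Probability.Process.IsRootedHardCore δ μ) → Literature.Probability.Process.IsPointStationaryLaw P → (∫ μ, Literature.MathematicalPhysics.StatisticalMechanics.rootEnergy Literature.MathematicalPhysics.StatisticalMechanics.lennardJones μ ∂P) ≤ (⨅ Q : Literature.MathematicalPhysics.StatisticalMechanics.PeriodicConfiguration 3, Q.energyPerParticle Literature.MathematicalPhysics.StatisticalMechanics.lennardJones) → (∀ᵐ μ ∂P, ∃ S : Set (EuclideanSpace ℝ (Fin 3)), μ = (MeasureTheory.Measure.count : MeasureTheory.Measure (EuclideanSpace ℝ (Fin 3))).restrict S ∧ (∀ x ∈ S, (∃ a : ℝ, 9 / 10 ≤ a ∧ a ≤ 1 ∧ ∃ T : Finset (EuclideanSpace ℝ (Fin 3)), (↑T : Set (EuclideanSpace ℝ (Fin 3))) = (fun y : EuclideanSpace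 ℝ (Fin 3) => y - x) '' {y : EuclideanSpace ℝ (Fin 3) | y ∈ S ∧ y ≠ x ∧ dist y x ≤ 5 / 4 * a} ∧ (Literature.Geometry.DiscreteGeometry.ShellCloseTo (a / 100) T (Finset.image (fun v : EuclideanSpace ℝ (Fin 3) => a • v) Literature.Geometry.DiscreteGeometry.fccKissingPattern) ∨ Literature.Geometry.DiscreteGeometry.ShellCloseTo (a / 100) T (Finset.image (fun v : EuclideanSpace ℝ (Fin 3) => a • v) Literature.Geometry.DiscreteGeometry.hcpKissingPattern)))) ∧ (∃ s : ℤ → ℤ, Literature.MathematicalPhysics.StatisticalMechanics.IsHaggSeq s ∧ ∃ Φ : EuclideanSpace ℝ (Fin 3) → EuclideanSpace ℝ (Fin 3), Set.BijOn Φ (Literature.MathematicalPhysics.StatisticalMechanics.barlowStacking 1 (Real.sqrt (2 / 3)) s) S ∧ ∀ p ∈ Literature.MathematicalPhysics.StatisticalMechanics.barlowStacking 1 (Real.sqrt (2 / 3)) s, ∀ q ∈ Literature.MathematicalPhysics.StatisticalMechanics.barlowStacking 1 (Real.sqrt (2 / 3)) s, (dist p q = 1 ↔ (0 < dist (Φ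 p) (Φ q) ∧ dist (Φ p) (Φ q) ≤ 28 / 25)))) → ∃ Q : Literature.MathematicalPhysics.StatisticalMechanics.PeriodicConfiguration 3, ∀ R ε : ℝ, 0 < R → 0 < ε → 0 < P {μ | ∃ A : EuclideanSpace ℝ (Fin 3) →ₗᵢ[ℝ] EuclideanSpace ℝ (Fin 3), ∃ q ∈ Q.points, (∀ s ∈ Q.points, dist s q ≤ R → ∃ y : EuclideanSpace ℝ (Fin 3), μ {y} ≠ 0 ∧ dist y (A (s - q)) ≤ ε) ∧ (∀ y : EuclideanSpace ℝ (Fin 3), μ {y} ≠ 0 → ‖y‖ ≤ R → ∃ s ∈ Q.points, dist y (A (s - q)) ≤ ε)}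

example : MinimiserShells ↔
    Summit.AtomisticToContinuum.Crystallization.Theses.PalmUnimodularRigidity.MinimiserShells := Iff.rfl

/-! ## Glue (real proofs; same text as `Cruxes/GroundStatesChargePeriodic/{Split,Pieces}.lean`) -/

/-! ## The deterministic matching step -/

/-- **From a matched charged configuration to a matched periodic pattern.**  If the configuration
`ν` is two-way `(ε/2)`-matched on the ball of radius `R + ε/2` with the rotated, re-based periodic
point set `A (Q.points - q)`, and the recentred finite configuration `{x k - x i}` is two-way
`(ε/2)`-matched on the ball of radius `R + ε/2` with the atoms of `ν`, then the `R`-neighbourhood of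
particle `i` is two-way `ε`-matched with `x i + A (Q.points - q)` — the matching clause of
`GroundStatesChargePeriodic`. [folklore] -/
theorem matched_periodic_of_matched_event {N : ℕ} (x : Fin N → EuclideanSpace ℝ (Fin 3))
    (i : Fin N) (Q : PeriodicConfiguration 3) {R ε : ℝ} (hε : 0 ≤ ε)
    (ν : Measure (EuclideanSpace ℝ (Fin 3)))
    (A : EuclideanSpace ℝ (Fin 3) →ₗᵢ[ℝ] EuclideanSpace ℝ (Fin 3))
    {q : EuclideanSpace ℝ (Fin 3)}
    (hQ1 : ∀ s ∈ Q.points, dist s q ≤ R + ε / 2 →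
      ∃ y : EuclideanSpace ℝ (Fin 3), ν {y} ≠ 0 ∧ dist y (A (s - q)) ≤ ε / 2)
    (hQ2 : ∀ y : EuclideanSpace ℝ (Fin 3), ν {y} ≠ 0 → ‖y‖ ≤ R + ε / 2 →
      ∃ s ∈ Q.points, dist y (A (s - q)) ≤ ε / 2)
    (h1 : ∀ p : EuclideanSpace ℝ (Fin 3), ν {p} ≠ 0 → ‖p‖ ≤ R + ε / 2 →
      ∃ q' ∈ Set.range (fun k : Fin N => x k - x i), dist q' p ≤ ε / 2)
    (h2 : ∀ q' ∈ Set.range (fun k : Fin N => x k - x i), ‖q'‖ ≤ R + ε / 2 →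
      ∃ p : EuclideanSpace ℝ (Fin 3), ν {p} ≠ 0 ∧ dist q' p ≤ ε / 2) :
    (∀ s ∈ Q.points, dist s q ≤ R → ∃ j : Fin N, dist (x j) (x i + A (s - q)) ≤ ε) ∧
      (∀ j : Fin N, dist (x j) (x i) ≤ R → ∃ s ∈ Q.points, dist (x j) (x i + A (s - q)) ≤ ε) := by
  have hkey : ∀ (j : Fin N) (s : EuclideanSpace ℝ (Fin 3)),
      dist (x j) (x i + A (s - q)) = dist (x j - x i) (A (s - q)) := by
    intro j s
    rw [dist_eq_norm, dist_eq_norm, sub_add_eq_sub_sub]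
  have hnA : ∀ s : EuclideanSpace ℝ (Fin 3), ‖A (s - q)‖ = dist s q := by
    intro s
    rw [LinearIsometry.norm_map, dist_eq_norm]
  constructor
  · intro s hs hsR
    obtain ⟨y, hy, hyd⟩ := hQ1 s hs (by linarith)
    have hyn : ‖y‖ ≤ R + ε / 2 := by
      calc ‖y‖ = dist y 0 := (dist_zero_right _).symm
        _ ≤ dist y (A (s - q)) + dist (A (s - q)) 0 := dist_triangle _ _ _
        _ ≤ ε / 2 + R := by
            rw [dist_zero_right, hnA]; exact add_le_add hyd hsR
        _ = R + ε / 2 := by ring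
    obtain ⟨q', ⟨k, rfl⟩, hk⟩ := h1 y hy hyn
    refine ⟨k, ?_⟩
    rw [hkey]
    calc dist (x k - x i) (A (s - q)) ≤ dist (x k - x i) y + dist y (A (s - q)) :=
          dist_triangle _ _ _
      _ ≤ ε / 2 + ε / 2 := add_le_add hk hyd
      _ = ε := by ring
  · intro j hj
    have hq' : x j - x i ∈ Set.range (fun k : Fin N => x k - x i) := ⟨j, rfl⟩
    have hq'n : ‖x j - x i‖ ≤ R + ε / 2 := by
      rw [← dist_eq_norm]; linarith
    obtain ⟨p, hp, hpd⟩ := h2 _ hq' hq'n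
    have hpn : ‖p‖ ≤ R + ε / 2 := by
      calc ‖p‖ = dist p 0 := (dist_zero_right _).symm
        _ ≤ dist p (x j - x i) + dist (x j - x i) 0 := dist_triangle _ _ _
        _ ≤ ε / 2 + R := by
            rw [dist_zero_right, dist_comm, ← dist_eq_norm]; exact add_le_add hpd hj
        _ = R + ε / 2 := by ring
    obtain ⟨s, hs, hsd⟩ := hQ2 p hp hpn
    refine ⟨s, hs, ?_⟩
    rw [hkey]
    calc dist (x j - x i) (A (s - q)) ≤ dist (x j - x i) p + dist p (A (s - q)) :=
          dist_triangle _ _ _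
      _ ≤ ε / 2 + ε / 2 := add_le_add hpd hsd
      _ = ε := by ring

/-! ## The assembly of the split -/

/-- **The typed split of the hinge** (route `BenjaminiSchrammPeriodicSupport`, layer 2):
`PeriodicSupport → BenjaminiSchrammLimit → CrysEnergyLimit → GroundStatesChargePeriodic`.
Periodic support of the minimising point-stationary hard-core laws (the Palm-side crux), the
Benjamini–Schramm limit of the ground states (construction, proved) and the energy limit
`E(N)/N → e*` (proved) give ONE periodic configuration charged with positive density at every
scale, frequently in `N`. [AldousLyons2007 §2; AldousSteele2004; BlancLewin2015 §2.1] -/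
theorem GroundStatesChargePeriodic_of_subs :
    PeriodicSupport → BenjaminiSchrammLimit → CrysEnergyLimit → GroundStatesChargePeriodic := by
  intro hPS hBS hLim x hx
  obtain ⟨φ, hφ, δ, hδ, P, hP, hcore, hstat, hE, htr⟩ := hBS x hx
  -- the Benjamini–Schramm limit is minimising: `E_P[h] = lim E(φ j)/φ j = e*`
  have hlim' : Tendsto (fun j : ℕ => groundStateEnergy lennardJones 3 (φ j) / (φ j : ℝ)) atTop
      (𝓝 (⨅ Q : PeriodicConfiguration 3, Q.energyPerParticle lennardJones)) :=
    hLim.comp hφ.tendsto_atTop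
  have hEq := tendsto_nhds_unique hE hlim'
  -- fold the frame of `BenjaminiSchrammLimit` into the three landed notions
  have hcore' : ∀ᵐ μ ∂P, Literature.Probability.Process.IsRootedHardCore δ μ := hcore
  have hstat' : Literature.Probability.Process.IsPointStationaryLaw P := hstat
  have hmin : (∫ μ, rootEnergy lennardJones μ ∂P) ≤
      ⨅ Q : PeriodicConfiguration 3, Q.energyPerParticle lennardJones := hEq.le
  -- ONE periodic configuration charged at every scale
  obtain ⟨Q, hQ⟩ := hPS δ hδ P hP hcore' hstat' hmin
  refine ⟨Q, fun R ε hR hε => ?_⟩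
  -- the matching event at radius `R + ε/2`, tolerance `ε/2`
  set T : Set (Measure (EuclideanSpace ℝ (Fin 3))) :=
    {μ | ∃ A : EuclideanSpace ℝ (Fin 3) →ₗᵢ[ℝ] EuclideanSpace ℝ (Fin 3), ∃ q ∈ Q.points,
      (∀ s ∈ Q.points, dist s q ≤ R + ε / 2 →
        ∃ y : EuclideanSpace ℝ (Fin 3), μ {y} ≠ 0 ∧ dist y (A (s - q)) ≤ ε / 2) ∧
      (∀ y : EuclideanSpace ℝ (Fin 3), μ {y} ≠ 0 → ‖y‖ ≤ R + ε / 2 →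
        ∃ s ∈ Q.points, dist y (A (s - q)) ≤ ε / 2)} with hTdef
  have hT : 0 < P T := hQ (R + ε / 2) (ε / 2) (by positivity) (half_pos hε)
  have hTreal : 0 < (P T).toReal := ENNReal.toReal_pos hT.ne' (measure_ne_top P T)
  refine ⟨(P T).toReal / 2, half_pos hTreal, ?_⟩
  have hev := htr T (R + ε / 2) (ε / 2) (half_pos hε) ((P T).toReal / 2) (half_lt_self hTreal)
  -- the property transferred to `N = φ j`
  set good : (N : ℕ) → Fin N → Prop := fun N i =>
    ∃ A : EuclideanSpace ℝ (Fin 3) →ₗᵢ[ℝ] EuclideanSpace ℝ (Fin 3), ∃ q ∈ Q.points,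
      (∀ s ∈ Q.points, dist s q ≤ R → ∃ j : Fin N, dist (x N j) (x N i + A (s - q)) ≤ ε) ∧
      (∀ j : Fin N, dist (x N j) (x N i) ≤ R →
        ∃ s ∈ Q.points, dist (x N j) (x N i + A (s - q)) ≤ ε)
    with hgood
  have himp : ∀ (N : ℕ) (i : Fin N),
      (∃ ν ∈ T, ((∀ p : EuclideanSpace ℝ (Fin 3), ν {p} ≠ 0 → ‖p‖ ≤ R + ε / 2 →
          ∃ q ∈ (Set.range (fun k : Fin N => x N k - x N i)), dist q p ≤ ε / 2) ∧
        (∀ q ∈ (Set.range (fun k : Fin N => x N k - x N i)), ‖q‖ ≤ R + ε / 2 →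
          ∃ p : EuclideanSpace ℝ (Fin 3), ν {p} ≠ 0 ∧ dist q p ≤ ε / 2))) → good N i := by
    rintro N i ⟨ν, ⟨A, q, hq, hQ1, hQ2⟩, h1, h2⟩
    obtain ⟨c1, c2⟩ := matched_periodic_of_matched_event (x N) i Q hε.le ν A hQ1 hQ2 h1 h2
    exact ⟨A, q, hq, c1, c2⟩
  have hev' : ∀ᶠ j : ℕ in atTop,
      (P T).toReal / 2 * ((φ j : ℕ) : ℝ) ≤ (Nat.card {i : Fin (φ j) // good (φ j) i} : ℝ) := by
    filter_upwards [hev] with j hj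
    refine hj.trans ?_
    exact_mod_cast Nat.card_le_card_of_injective _
      (Subtype.map_injective (fun i hi => himp (φ j) i hi) Function.injective_id)
  exact hφ.tendsto_atTop.frequently
    (p := fun N : ℕ => (P T).toReal / 2 * (N : ℝ) ≤ (Nat.card {i : Fin N // good N i} : ℝ))
    hev'.frequently

/-- **Measure-level composition** (as `Pieces.periodicSupport_of_pieces`): piece 1 at the root, Aldous–Lyons transfer to every
point, the PROVED layer theorem 9227, then piece 2. -/
theorem periodicSupport_of_pieces (hShells : MinimiserShells)
    (hChart : Summit.AtomisticToContinuum.Crystallization.Theses.PalmUnimodularRigidity.ShellsToBarlowChart)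
    (hSelect : LayeredLawsChargePeriodic) : PeriodicSupport := by
  intro δ hδ P hP hcore hstat hmin
  have hroot := hShells δ hδ P hP hcore hstat hmin
  have hlf : ∀ᵐ μ ∂P, ∀ n : ℕ,
      μ ((fun z : EuclideanSpace ℝ (Fin 3) => ⌊‖z‖⌋₊) ⁻¹' {n}) < ∞ := by
    filter_upwards [hcore] with μ hμ n
    obtain ⟨S, -, hsep, rfl⟩ := hμ
    exact Summit.AtomisticToContinuum.Crystallization.Theorems.PalmUnimodularRigidity.count_restrict_floorNorm_preimage_lt_top
      hδ hsep n
  have hall := Summit.AtomisticToContinuum.Crystallization.Theorems.PalmUnimodularRigidity.ae_forall_map_sub_of_ae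
    hstat hlf hroot
  refine hSelect δ hδ P hP hcore hstat hmin ?_
  filter_upwards [hcore, hall] with μ hc ha
  obtain ⟨S, h0, hsep, rfl⟩ := hc
  refine ⟨S, rfl, ?good, hChart S ⟨0, h0⟩ ?good⟩
  intro x hx
  obtain ⟨a, ha1, ha2, T, hT, hsh⟩ := ha x ((count_restrict_singleton_ne_zero_iff S x).2 hx)
  refine ⟨a, ha1, ha2, T, ?_, hsh⟩
  rw [hT, map_sub_count_restrict,
    Summit.AtomisticToContinuum.Crystallization.Theorems.PalmUnimodularRigidity.shell_image_sub_eq]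

/-- The glue of the split over the route's decls: `MinimiserShells → LayeredLawsChargePeriodic → GroundStatesChargePeriodic`
(9227, 9230, 0626 from the tree). -/
theorem groundStatesChargePeriodic_of_pieces (hShells : MinimiserShells) (hSelect : LayeredLawsChargePeriodic) :
    GroundStatesChargePeriodic :=
  GroundStatesChargePeriodic_of_subs
    (periodicSupport_of_pieces hShells
      Summit.AtomisticToContinuum.Crystallization.Cruxes.ShellsToBarlowChart.DevelopTheModelGrowthDescent.ShellsToBarlowChart_of
      hSelect)
    (by
      unfold BenjaminiSchrammLimit
      exact Summit.AtomisticToContinuum.Crystallization.Theorems.benjaminiSchrammLimit_proof)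
    (by
      unfold CrysEnergyLimit
      exact Summit.AtomisticToContinuum.Crystallization.Theorems.crysEnergyLimit_proof)

/-! ## Symbolic coordinates: exactly relaxed layered stackings -/

/-- The point `(i, j)` of layer `k` of the RELAXED layered stacking with in-layer spacing `a`, height
sequence `t` and Hägg word `s`: `i u_a + j v_a + (haggLabel s k) w_a + (t k) e₃` (for `t k = k h` this
is `barlowPos a h s k i j`). -/
def layeredPos (a : ℝ) (t : ℤ → ℝ) (s : ℤ → ℤ) (k i j : ℤ) : E3 :=
  (i : ℝ) • triangularVec₁ a + (j : ℝ) • triangularVec₂ a +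
    (haggLabel s k : ℝ) • barlowOffset a + (t k) • layerNormal 1

/-- The relaxed layered stacking `{layeredPos a t s k i j}` as a point set. -/
def layeredStacking (a : ℝ) (t : ℤ → ℝ) (s : ℤ → ℤ) : Set E3 :=
  {x | ∃ k i j : ℤ, x = layeredPos a t s k i j}

/-- Sanity: uniform heights give the Literature Barlow stacking. -/
theorem layeredPos_eq_barlowPos (a h : ℝ) (s : ℤ → ℤ) (k i j : ℤ) :
    layeredPos a (fun k => (k : ℝ) * h) s k i j = barlowPos a h s k i j := by
  simp only [layeredPos, barlowPos, layerNormal]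
  congr 1
  ext l
  fin_cases l <;> simp

/-- **The rooted counting measure of an exact relaxed layered stacking, rotated by `A` and re-based at
its point `(k₀, i₀, j₀)`.** -/
def exactLaw (A : E3 →ₗᵢ[ℝ] E3) (a : ℝ) (t : ℤ → ℝ) (s : ℤ → ℤ) (k₀ i₀ j₀ : ℤ) : Measure E3 :=
  (Measure.count : Measure E3).restrict
    ((fun z : E3 => A (z - layeredPos a t s k₀ i₀ j₀)) '' layeredStacking a t s)

/-- `μ` IS an exact rotated re-based relaxed layered stacking (some `A`, `a > 0`, heights `t` with
interlayer spacings `≥ 1/2` — close-packed layers at scale `a ∈ [9/10, 1]` are `≈ a√(2/3) ≥ 0.72`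
apart, so `1/2` is a safe one-sided interface constant — Hägg word `s`, root label `(k₀, i₀, j₀)`). -/
def IsExactLayered (μ : Measure E3) : Prop :=
  ∃ A : E3 →ₗᵢ[ℝ] E3, ∃ a : ℝ, ∃ t : ℤ → ℝ, ∃ s : ℤ → ℤ, ∃ k₀ i₀ j₀ : ℤ,
    0 < a ∧ (∀ k, 1 / 2 ≤ t (k + 1) - t k) ∧ IsHaggSeq s ∧ μ = exactLaw A a t s k₀ i₀ j₀

/-- **The window event**: `μ` is an exact relaxed layered stacking whose in-layer spacing is
`η`-close to `a₀` and whose word and spacings, read on the `L` layers above and below the ROOT's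
layer, agree with a shift of the reference word `w` and are `η`-close to the reference spacings of
`t₀`. -/
def WindowEvent (a₀ : ℝ) (t₀ : ℤ → ℝ) (w : ℤ → ℤ) (η : ℝ) (L : ℕ) : Set (Measure E3) :=
  {μ | ∃ A : E3 →ₗᵢ[ℝ] E3, ∃ a : ℝ, ∃ t : ℤ → ℝ, ∃ s : ℤ → ℤ, ∃ k₀ i₀ j₀ m : ℤ,
    0 < a ∧ (∀ k, 1 / 2 ≤ t (k + 1) - t k) ∧ IsHaggSeq s ∧ |a - a₀| ≤ η ∧
    (∀ k : ℤ, |k| ≤ L → s (k₀ + k) = w (m + k) ∧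
      |(t (k₀ + k + 1) - t (k₀ + k)) - (t₀ (m + k + 1) - t₀ (m + k))| ≤ η) ∧
    μ = exactLaw A a t s k₀ i₀ j₀}

/-- **The matching event of the crux** at scale `(R, ε)` for the periodic configuration `Q`
(verbatim the set in the conclusion of `LayeredLawsChargePeriodic`). -/
def MatchEvent (Q : PeriodicConfiguration 3) (R ε : ℝ) : Set (Measure E3) :=
  {μ | ∃ A : EuclideanSpace ℝ (Fin 3) →ₗᵢ[ℝ] EuclideanSpace ℝ (Fin 3), ∃ q ∈ Q.points, (∀ s ∈ Q.points, dist s q ≤ R → ∃ y : EuclideanSpace ℝ (Fin 3), μ {y} ≠ 0 ∧ dist y (A (s - q)) ≤ ε) ∧ (∀ y : EuclideanSpace ℝ (Fin 3), μ {y} ≠ 0 → ‖y‖ ≤ R → ∃ s ∈ Q.points, dist y (A (s - q)) ≤ ε)}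

/-! ## The three registered stubs -/

/-- **STUB 1 — `stub_exactLayered` (RIGIDITY of minimising layered laws; XL, word-agnostic analogue of
the sibling's `stub_hcpTubeRigidity`).**  A minimising point-stationary hard-core law that is a.s.
layered (every point `(a/100)`-close-packed at a scale `a ∈ [9/10, 1]`, one global bond chart from an
ideal Barlow stacking) is a.s. an EXACT rotated re-based relaxed layered stacking
`A (layeredStacking a t s − c)`: uniform in-layer spacing, symmetric `A/B/C` registry, free heights.
Why plausibly true: every close-packed LJ stacking is strictly mechanically stable, so a stationary
distortion field on top of the charted configuration costs energy at second order (mass transport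
kills the first order, as in the landed `CorrMeanZero` files of the sibling line) while `E_P[h] ≤ e*`
leaves no room; heights stay free because faults DO relax the spacings.  Why it might fail: only if
some close-packed stacking had a zero-energy distortion mode at law level (none is known), or if
`e* < inf over layered laws` (then the stub is vacuous, not false). -/
theorem stub_exactLayered :
    ∀ δ : ℝ, 0 < δ → ∀ P : Measure (Measure E3), IsProbabilityMeasure P →
      (∀ᵐ μ ∂P, IsRootedHardCore δ μ) → IsPointStationaryLaw P →
      (∫ μ, rootEnergy lennardJones μ ∂P) ≤
        (⨅ Q : PeriodicConfiguration 3, Q.energyPerParticle lennardJones) →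
      (∀ᵐ μ ∂P, ∃ S : Set E3, μ = (Measure.count : Measure E3).restrict S ∧
        (∀ x ∈ S, (∃ a : ℝ, 9 / 10 ≤ a ∧ a ≤ 1 ∧ ∃ T : Finset E3,
          (↑T : Set E3) = (fun y : E3 => y - x) '' {y : E3 | y ∈ S ∧ y ≠ x ∧ dist y x ≤ 5 / 4 * a} ∧
          (Literature.Geometry.DiscreteGeometry.ShellCloseTo (a / 100) T
              (Finset.image (fun v : E3 => a • v) Literature.Geometry.DiscreteGeometry.fccKissingPattern) ∨
            Literature.Geometry.DiscreteGeometry.ShellCloseTo (a / 100) T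
              (Finset.image (fun v : E3 => a • v) Literature.Geometry.DiscreteGeometry.hcpKissingPattern)))) ∧
        (∃ s : ℤ → ℤ, IsHaggSeq s ∧ ∃ Φ : E3 → E3,
          Set.BijOn Φ (barlowStacking 1 (Real.sqrt (2 / 3)) s) S ∧
          ∀ p ∈ barlowStacking 1 (Real.sqrt (2 / 3)) s, ∀ q ∈ barlowStacking 1 (Real.sqrt (2 / 3)) s,
            (dist p q = 1 ↔ (0 < dist (Φ p) (Φ q) ∧ dist (Φ p) (Φ q) ≤ 28 / 25)))) →
      ∀ᵐ μ ∂P, IsExactLayered μ := by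
  sorry

/-- **STUB 2 — `stub_periodicWindowCharged` (SELECTION IN SUPPORT, symbolic coordinates; L/XL; the
TRANSFER `C⁺` of the crux and its heart).**  A minimising point-stationary hard-core law that is a.s.
an exact relaxed layered stacking charges ONE periodic reference at every window length: there are
`a₀ > 0`, a period `p`, a `p`-periodic Hägg word `w` and reference heights `t₀` with positive
`p`-periodic increments such that for every `η > 0` and `L` the window event has positive
`P`-measure.  Why plausibly true / why easier: seen from the root layer the law of `(s, t)` is
shift-stationary and `E_P[h]` is the mean of an explicit shift-invariant lattice-sum functional, so
minimising laws are carried by ground-state sequences of a 1-D effective layer interaction with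
summable, `J₂`-dominated couplings; periodic ground states exist for every finite-range truncation
(Radin–Schulman 1983) and degenerate couplings only enlarge the set of charged windows; `w` is
EXISTENTIAL, so no hcp-vs-fcc-vs-polytype inequality is claimed.  Why it might fail: a
devil's-staircase regime (Bak–Bruinsma 1982; Aubry) of infinitely many competing effective couplings
would make the minimising word laws uniquely ergodic and aperiodic (Sturmian), charging no fixed
periodic word at all lengths — excluded for LJ only through quantitative control of the `r⁻⁶` layer
couplings (cf. items 0670/0737, uncertified). -/
theorem stub_periodicWindowCharged :
    ∀ δ : ℝ, 0 < δ → ∀ P : Measure (Measure E3), IsProbabilityMeasure P →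
      (∀ᵐ μ ∂P, IsRootedHardCore δ μ) → IsPointStationaryLaw P →
      (∫ μ, rootEnergy lennardJones μ ∂P) ≤
        (⨅ Q : PeriodicConfiguration 3, Q.energyPerParticle lennardJones) →
      (∀ᵐ μ ∂P, IsExactLayered μ) →
      ∃ a₀ : ℝ, 0 < a₀ ∧ ∃ p : ℕ, p ≠ 0 ∧ ∃ w : ℤ → ℤ, IsHaggSeq w ∧ (∀ i, w (i + p) = w i) ∧
        ∃ t₀ : ℤ → ℝ, (∀ k, 0 < t₀ (k + 1) - t₀ k) ∧ (∀ k, t₀ (k + 1 + p) - t₀ (k + p) = t₀ (k + 1) - t₀ k) ∧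
        ∀ η : ℝ, 0 < η → ∀ L : ℕ, 0 < P (WindowEvent a₀ t₀ w η L) := by
  sorry

/-- **STUB 3 — `stub_windowMatching` (DETERMINISTIC GEOMETRY; M).**  A periodic reference
(`a₀ > 0`, `p`-periodic Hägg word `w`, heights `t₀` with positive `p`-periodic increments) is the point
set of a `PeriodicConfiguration 3` (lattice `ℤu + ℤv + ℤ(W w + H e₃)`, motif `p` points, as in
`barlowPeriodicConfiguration`), and for all `R, ε > 0` there are `η > 0` and `L` such that every law in
the window event is in the matching event of the crux at `(R, ε)`: take the same rotation `A` and the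
base point `q = layeredPos a₀ t₀ w m i₀ j₀`; inside the window the label differences of `s` and of the
shifted `w` agree (`haggLabel_add_natCast`), so corresponding points differ by at most `C·R·η/a₀`
(index-by-index, cf. the landed `dist_barlowPos_barlowPos_le` of `PalmToHinge`); reference points
within `R` of `q` lie in layers `|k' − m| ≤ R / min_k (t₀ (k+1) − t₀ k)` and atoms within `R` of the
root lie in layers `|k − k₀| ≤ 2R` (all spacings are `≥ 1/2`), so `L = ⌈R / d_min⌉ + ⌈2R⌉ + 1` sees
every point that has to be matched.  Why it might fail: it does not; bookkeeping only. -/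
theorem stub_windowMatching :
    ∀ a₀ : ℝ, 0 < a₀ → ∀ p : ℕ, p ≠ 0 → ∀ w : ℤ → ℤ, IsHaggSeq w → (∀ i, w (i + p) = w i) →
      ∀ t₀ : ℤ → ℝ, (∀ k, 0 < t₀ (k + 1) - t₀ k) →
        (∀ k, t₀ (k + 1 + p) - t₀ (k + p) = t₀ (k + 1) - t₀ k) →
      ∃ Q : PeriodicConfiguration 3, Q.points = layeredStacking a₀ t₀ w ∧
        ∀ R ε : ℝ, 0 < R → 0 < ε → ∃ η : ℝ, 0 < η ∧ ∃ L : ℕ,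
          WindowEvent a₀ t₀ w η L ⊆ MatchEvent Q R ε := by
  sorry

/-! ## The composition (real proof) -/

/-- **SKELETON THEOREM — the crux `LayeredLawsChargePeriodic` from the three stubs.**  Rigidity puts
the law a.s. in symbolic coordinates; selection-in-support gives ONE periodic reference whose window
events are charged; the geometry turns the reference into a periodic configuration `Q` (chosen before
`R, ε`) and each window event into a sub-event of the matching event; monotonicity of the (outer)
measure finishes. -/
theorem LayeredLawsChargePeriodic_of_stubs
    (h1 : ∀ δ : ℝ, 0 < δ → ∀ P : Measure (Measure E3), IsProbabilityMeasure P →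
      (∀ᵐ μ ∂P, IsRootedHardCore δ μ) → IsPointStationaryLaw P →
      (∫ μ, rootEnergy lennardJones μ ∂P) ≤
        (⨅ Q : PeriodicConfiguration 3, Q.energyPerParticle lennardJones) →
      (∀ᵐ μ ∂P, ∃ S : Set E3, μ = (Measure.count : Measure E3).restrict S ∧
        (∀ x ∈ S, (∃ a : ℝ, 9 / 10 ≤ a ∧ a ≤ 1 ∧ ∃ T : Finset E3,
          (↑T : Set E3) = (fun y : E3 => y - x) '' {y : E3 | y ∈ S ∧ y ≠ x ∧ dist y x ≤ 5 / 4 * a} ∧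
          (Literature.Geometry.DiscreteGeometry.ShellCloseTo (a / 100) T
              (Finset.image (fun v : E3 => a • v) Literature.Geometry.DiscreteGeometry.fccKissingPattern) ∨
            Literature.Geometry.DiscreteGeometry.ShellCloseTo (a / 100) T
              (Finset.image (fun v : E3 => a • v) Literature.Geometry.DiscreteGeometry.hcpKissingPattern)))) ∧
        (∃ s : ℤ → ℤ, IsHaggSeq s ∧ ∃ Φ : E3 → E3,
          Set.BijOn Φ (barlowStacking 1 (Real.sqrt (2 / 3)) s) S ∧
          ∀ p ∈ barlowStacking 1 (Real.sqrt (2 / 3)) s, ∀ q ∈ barlowStacking 1 (Real.sqrt (2 / 3)) s,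
            (dist p q = 1 ↔ (0 < dist (Φ p) (Φ q) ∧ dist (Φ p) (Φ q) ≤ 28 / 25)))) →
      ∀ᵐ μ ∂P, IsExactLayered μ)
    (h2 : ∀ δ : ℝ, 0 < δ → ∀ P : Measure (Measure E3), IsProbabilityMeasure P →
      (∀ᵐ μ ∂P, IsRootedHardCore δ μ) → IsPointStationaryLaw P →
      (∫ μ, rootEnergy lennardJones μ ∂P) ≤
        (⨅ Q : PeriodicConfiguration 3, Q.energyPerParticle lennardJones) →
      (∀ᵐ μ ∂P, IsExactLayered μ) →
      ∃ a₀ : ℝ, 0 < a₀ ∧ ∃ p : ℕ, p ≠ 0 ∧ ∃ w : ℤ → ℤ, IsHaggSeq w ∧ (∀ i, w (i + p) = w i) ∧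
        ∃ t₀ : ℤ → ℝ, (∀ k, 0 < t₀ (k + 1) - t₀ k) ∧ (∀ k, t₀ (k + 1 + p) - t₀ (k + p) = t₀ (k + 1) - t₀ k) ∧
        ∀ η : ℝ, 0 < η → ∀ L : ℕ, 0 < P (WindowEvent a₀ t₀ w η L))
    (h3 : ∀ a₀ : ℝ, 0 < a₀ → ∀ p : ℕ, p ≠ 0 → ∀ w : ℤ → ℤ, IsHaggSeq w → (∀ i, w (i + p) = w i) →
      ∀ t₀ : ℤ → ℝ, (∀ k, 0 < t₀ (k + 1) - t₀ k) →
        (∀ k, t₀ (k + 1 + p) - t₀ (k + p) = t₀ (k + 1) - t₀ k) →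
      ∃ Q : PeriodicConfiguration 3, Q.points = layeredStacking a₀ t₀ w ∧
        ∀ R ε : ℝ, 0 < R → 0 < ε → ∃ η : ℝ, 0 < η ∧ ∃ L : ℕ,
          WindowEvent a₀ t₀ w η L ⊆ MatchEvent Q R ε) :
    LayeredLawsChargePeriodic := by
  intro δ hδ P hP hcore hstat hmin hlay
  -- rigidity: a.s. the law is an exact relaxed layered stacking
  have hexact : ∀ᵐ μ ∂P, IsExactLayered μ := h1 δ hδ P hP hcore hstat hmin hlay
  -- selection in support: ONE periodic reference whose window events are all charged
  obtain ⟨a₀, ha₀, p, hp, w, hw, hwp, t₀, ht₀, ht₀p, hcharge⟩ :=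
    h2 δ hδ P hP hcore hstat hmin hexact
  -- geometry: the reference is a periodic configuration `Q`, chosen before `R, ε`
  obtain ⟨Q, -, hmatch⟩ := h3 a₀ ha₀ p hp w hw hwp t₀ ht₀ ht₀p
  refine ⟨Q, fun R ε hR hε => ?_⟩
  obtain ⟨η, hη, L, hsub⟩ := hmatch R ε hR hε
  -- the charged window event is a sub-event of the matching event
  exact (hcharge η hη L).trans_le (measure_mono hsub)

/-! ## Piece 1 as a stub, and the crux by name -/

/-- **STUB 0 — `stub_minimiserShells`** = piece 1 = item stmt-AtomisticToContinuum-9225 verbatim (shared open crux of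
`PalmUnimodularRigidity`; live lines under `Cruxes/MinimiserShells`). -/
theorem stub_minimiserShells : MinimiserShells := by
  sorry

/-- **SKELETON THEOREM — the crux `GroundStatesChargePeriodic` (route decl, BY NAME) from the four stubs**
(`sorry` only inside `stub_*`). -/
theorem GroundStatesChargePeriodic_proof :
    Summit.AtomisticToContinuum.Crystallization.Theses.BenjaminiSchrammPeriodicSupport.GroundStatesChargePeriodic :=
  groundStatesChargePeriodic_of_pieces stub_minimiserShells
    (LayeredLawsChargePeriodic_of_stubs stub_exactLayered stub_periodicWindowCharged stub_windowMatching)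

end

end Summit.AtomisticToContinuum.Crystallization.Cruxes.GroundStatesChargePeriodic.RedirectPieces
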